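import Summits.BirchSwinnertonDyer.Rank1Residual.Additive.X4RankZeroCoveredLocus
import Summits.BirchSwinnertonDyer.BirchSwinnertonDyer.Theorems.Rank1ResidualIntModelReduction
import Literature.NumberTheory.EllipticCurves.AgasheRibetStein2006.ManinConstantOptimalCurves
import Literature.NumberTheory.EllipticCurves.PastenValuationProductThm115Proofs
import Literature.NumberTheory.EllipticCurves.TamagawaNeZeroProofs
import HarnessLib

/-!
# X4 ∧ `r_an = 0` at the additive prime `3`: the chain of record FED BY KERNEL CERTIFICATES —
# `Addv` read off the integer model, the local Tamagawa binder from `3 ∤ ∏ c_ℓ`, the Manin binder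
# from an OPTIMAL datum (Agashe–Ribet–Stein 2006 Thm. 2.6), the tower from a record
# (cell `b2b-bsdres`, seat additive-p4 gen 15, line V25; per-pair records in
# `Additive/X4ThreeResCertRecords{1..5}.lean`)

HONEST FRAMING (cell `b2b-bsdres`, run/shared/lean/b2b/bsd-rank1-residual/, verbatim in every
file): the goal of the cell is to DELETE the COMBINATION-SHAPED residual classes of the
Birch–Swinnerton-Dyer formula for ALL analytic-rank `≤ 1` elliptic curves over `ℚ` — "full BSD
formula for every rank `≤ 1` curve in class `C`" assembled STRICTLY from published theorems — so
that the rank-`≤ 1` remainder becomes exactly the CONSTRUCTION-SHAPED classes, which are TYPED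
(missing-input `Prop`s), NOT attempted. This is not "finishing BSD". Sub-cell additive-p4 (X3♯/X4♯
direct): research route on the CONSTRUCTION-SHAPED class X4; no claim beyond the stated classes;
the label X4 is UNCHANGED by this file; nothing is booked. Theorems only (no definition, no named
fact minted; every published input is an explicit named-fact hypothesis of the tree).

## What this file proves

The cell's chain of record for X4 ∧ `r_an = 0` at every odd `p`
(`X4RankZero.bsdp_of_facts_of_shaAn_unit`, `Additive/X4RankZeroCoveredLocus.lean`) asks, on a
potentially good row at `p = 3`, for three per-pair binders besides the `L`-data: the `3`-adic
TOWER (`ρ̄_{E,3^n}` onto for all `n`), the local Tamagawa binder `ord₃ ∏ c_ℓ = ord₃ c₃`, and a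
modular parametrisation datum with Manin constant prime to `3`. This file turns each of them into
something the kernel or a published table supplies:

* §1 `localTamagawaNumber_padic_dvd_tamagawaProduct` — **`c_p ∣ ∏_ℓ c_ℓ`** at every prime `p`
  (the Tamagawa product is the finite product of the `ℚ_ℓ`-local Tamagawa numbers over the bad
  places, tree theorems `tamagawaProduct_eq_prod` / `finite_badPlaces_holds`); hence
  `padicValNat_tamagawaProduct_eq_local_of_not_dvd` — **`p ∤ ∏ c_ℓ ⟹ ord_p ∏ c_ℓ = ord_p c_p`**
  (both sides `0`) at ANY prime, in particular at `p = 3` where `3 ∣ c₃` is possible (Kodaira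
  IV/IV*) and gen 14's `p ≥ 5` lever `padicValNat_tamagawaProduct_eq_local_iff_not_dvd_of_addv`
  does not apply.
* §2 `addv_of_intModel` — **`Addv W p` from the integer model** of a globally minimal `W`:
  `p ∣ Δ(E₀)` and `p ∣ c₄(E₀)` (Silverman *AEC* VII.5.1 (c)); `classX4_three_of_intModel_of_surj`.
* §3 `exists_maninDatum_of_optimal` — an OPTIMAL parametrisation datum at a level `N ≤ 130000`
  (`Λ_E ⊆ c Λ_f`) has `|c| = 1`, hence `3 ∤ c` (Agashe–Ribet–Stein 2006 Thm. 2.6 = Cremona, named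
  fact `cremona_abs_maninConstant_eq_one_of_level_le`, binder `h26`).
* §4 **`X4RankZero.bsdp_three_of_towerSurj_of_optimal`** — X4-at-`3` chain of record with the three
  binders in certificate form: `Addv W 3`, surj(3), the tower `∀ n, ρ̄_{E,3^n}` onto, `r_an = 0`,
  `3 ∤ #Ш_an`, `3 ∤ ∏ c_ℓ`, an optimal datum at level `≤ 130000` ⟹ `BSD(E,3)`, from the five named
  facts of the chain (A161 sharp Kato `hKatoS`, Delbourgo Prop. 4 `hDel`, modular parametrisation
  data `hmodD`, Wuthrich L. 20 `hL20`, Kato half-eigen `hKatoχ`) + GZK + modularity + `h26`; and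
  `X4RankZero.bsdp_three_of_intModel_of_towerSurj_of_optimal` (the same with `Addv` read off the
  integer model). The records files instantiate it on the 35 window RES-CERT rows of census V21
  (X4 @ 3, `r_an = 0`, potentially good, no (ram)/`j`-witness prime, `3`-adic tower certified by
  lit-kato GEN 6's kernel records `GaloisImage.towerSurj3_v<label>`).

What is NOT changed: the class X4 stays CONSTRUCTION-SHAPED; the per-pair `L`-data (`r_an = 0`,
`#Ш_an`, `∏ c_ℓ`) and the optimality of the curve are hypotheses read from Cremona's tables; nothing
is booked by this file.

References: Kato 2004 [Kato2004Asterisque] Thm. 14.5 (3), Prop. 14.16 (2); Delbourgo 1998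
[Delbourgo1998] Prop. 4; Wuthrich 2014 [Wuthrich2014] Lemma 20; Agashe–Ribet–Stein 2006
[AgasheRibetStein2006] Thm. 2.6 and appendix Thm. 5.2; Silverman *AEC* [SilvermanAEC2009] VII.5.1,
VII.6.2; Miller 2011 [Miller2011LMS] Def. 1.1.
-/

noncomputable section

open scoped Classical

open WeierstrassCurve NumberField IsDedekindDomain Rat.HeightOneSpectrum
  Literature.NumberTheory.EllipticCurves
  Literature.NumberTheory.EllipticCurves.ModularForms
  Literature.NumberTheory.EllipticCurves.Rank1Residual
  Literature.NumberTheory.EllipticCurves.Rank1Residual.Typed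
  Literature.NumberTheory.EllipticCurves.AgasheRibetStein2006
  Summit.BirchSwinnertonDyer.BirchSwinnertonDyer.Rank1Residual.IntModel

namespace Summit.BirchSwinnertonDyer.Rank1Residual.Additive

/-! ### §1 `c_p ∣ ∏ c_ℓ`; the local Tamagawa binder from `p ∤ ∏ c_ℓ` -/

section Tamagawa

variable (W : WeierstrassCurve ℚ) [W.IsElliptic] (p : ℕ) [hp : Fact p.Prime]

/-- **`c_p(E) ∣ ∏_ℓ c_ℓ(E)`**: the `ℚ_p`-local Tamagawa number is a factor of the Tamagawa
product, which is the finite product of the local Tamagawa numbers over any finite set of places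
of `ℤ` containing the bad ones (`tamagawaProduct_eq_prod`; the bad places are finite,
`finite_badPlaces_holds`). [cite: SilvermanAEC2009, VII.6 Cor. 6.2 and C.16 (Conj. 16.5)] -/
theorem localTamagawaNumber_padic_dvd_tamagawaProduct :
    (W.baseChange ℚ_[p]).localTamagawaNumber ℤ_[p] ∣ W.tamagawaProduct := by
  obtain ⟨v, hv⟩ : ∃ v : HeightOneSpectrum ℤ, (primesEquiv v : ℕ) = p :=
    ⟨primesEquiv.symm ⟨p, hp.out⟩, by rw [Equiv.apply_symm_apply]⟩
  have hfW : (W.badPlaces ℤ).Finite := W.finite_badPlaces_holds ℤ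
  set s : Finset (HeightOneSpectrum ℤ) := insert v hfW.toFinset with hsdef
  have hsW : ∀ w, ¬ W.HasGoodReductionAt w → w ∈ s := fun w hw ↦
    Finset.mem_insert_of_mem (by rw [Set.Finite.mem_toFinset, mem_badPlaces_iff]; exact hw)
  rw [tamagawaProduct_eq_prod W s hsW]
  refine dvd_trans ?_ (Finset.dvd_prod_of_mem _ (Finset.mem_insert_self v _))
  have key : ∀ (q : ℕ) (hq : Fact q.Prime), (primesEquiv v : ℕ) = q →
      @WeierstrassCurve.localTamagawaNumber ℤ_[q] _ _ _ ℚ_[q] _ _ _ (W.baseChange ℚ_[q]) ∣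
        (haveI := Fact.mk (primesEquiv v).2
         (W.baseChange ℚ_[primesEquiv v]).localTamagawaNumber ℤ_[primesEquiv v]) := by
    rintro q hq rfl; exact dvd_rfl
  exact key p hp hv

/-- **`p ∤ ∏_ℓ c_ℓ ⟹ ord_p ∏_ℓ c_ℓ = ord_p c_p`** (both sides vanish: `c_p ∣ ∏ c_ℓ`), at ANY prime
`p` — the local Tamagawa binder of the sharp Kato reading (A161) in its census form. At `p = 3`
this is not covered by gen 14's `padicValNat_tamagawaProduct_eq_local_iff_not_dvd_of_addv`
(`p ≥ 5`, where `c_p ≤ 4 < p`). [cite: SilvermanAEC2009, VII.6 Cor. 6.2] -/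
theorem padicValNat_tamagawaProduct_eq_local_of_not_dvd (h : ¬ p ∣ W.tamagawaProduct) :
    padicValNat p W.tamagawaProduct =
      padicValNat p ((W.baseChange ℚ_[p]).localTamagawaNumber ℤ_[p]) := by
  rw [padicValNat.eq_zero_of_not_dvd h, padicValNat.eq_zero_of_not_dvd fun h' ↦
    h (dvd_trans h' (localTamagawaNumber_padic_dvd_tamagawaProduct W p))]

end Tamagawa

/-! ### §2 `Addv W p` and `ClassX4 W 3` from the integer model -/

section IntModel

variable {W : WeierstrassCurve ℚ} [W.IsElliptic] [W.IsGloballyMinimal] {E₀ : WeierstrassCurve ℤ}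
  (hI : integralModelInt W = E₀)
include hI

/-- **`Addv W p` from the integer model**: for the globally minimal `W` with integral model `E₀`,
`p ∣ Δ(E₀)` and `p ∣ c₄(E₀)` give ADDITIVE reduction at `p` (Silverman *AEC* VII.5.1 (c): the
minimal equation has `v(Δ) > 0` and `v(c₄) > 0`), i.e. neither good nor multiplicative reduction
(the cell's atom `Addv`). Same computation as `IntModel.not_semistable_of_intModel`.
[cite: SilvermanAEC2009, VII.5 Prop. 5.1 (c)] -/
theorem addv_of_intModel (p : ℕ) [hp : Fact p.Prime] (hΔ : (p : ℤ) ∣ E₀.Δ) (hc₄ : (p : ℤ) ∣ E₀.c₄) :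
    Addv W p := by
  set v : HeightOneSpectrum (𝓞 ℚ) := (primesEquiv (R := 𝓞 ℚ)).symm ⟨p, hp.out⟩ with hvdef
  have hv : primesEquiv v = ⟨p, hp.out⟩ := Equiv.apply_symm_apply _ _
  haveI : Fact (primesEquiv v : ℕ).Prime := ⟨(primesEquiv v).2⟩
  have hadd : W.HasAdditiveReductionAt v := by
    rw [hasAdditiveReductionAt_iff_of_isMinimalAt (IsGloballyMinimal.isMinimal (W := W) v),
      Δ_eq_cast hI, c₄_eq_cast hI, (valuation_equiv_padicValuation v).lt_one_iff_lt_one,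
      (valuation_equiv_padicValuation v).lt_one_iff_lt_one, Rat.padicValuation_cast,
      Rat.padicValuation_cast, Int.padicValuation_lt_one_iff, Int.padicValuation_lt_one_iff, hv]
    exact ⟨hΔ, hc₄⟩
  have key : ∀ q' : Nat.Primes, primesEquiv v = q' →
      (haveI := Fact.mk q'.2;
        ¬ W.HasGoodReductionAtPrime (q' : ℕ) ∧ ¬ W.HasMultiplicativeReductionAtPrime (q' : ℕ)) := by
    rintro q' rfl
    exact ⟨fun h ↦ hadd.not_hasGoodReductionAt
        ((hasGoodReductionAtPrime_iff_hasGoodReductionAt_ringOfIntegers v W).mp h),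
      fun h ↦ hadd.not_hasMultiplicativeReductionAt
        ((hasMultiplicativeReductionAtPrime_iff_hasMultiplicativeReductionAt_ringOfIntegers W v).mp h)⟩
  exact key ⟨p, hp.out⟩ hv

/-- **`ClassX4 W 3` from the integer model and surj(3)**: `3 ∣ Δ(E₀)`, `3 ∣ c₄(E₀)` (additive at
`3`) and `ρ̄_{E,3}` onto (so `E[3]` is irreducible). [cite: SilvermanAEC2009, VII.5 Prop. 5.1 (c)] -/
theorem classX4_three_of_intModel_of_surj (hΔ : (3 : ℤ) ∣ E₀.Δ) (hc₄ : (3 : ℤ) ∣ E₀.c₄)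
    (hsurj : haveI : Fact (Nat.Prime 3) := ⟨Nat.prime_three⟩; Surj W 3) :
    haveI : Fact (Nat.Prime 3) := ⟨Nat.prime_three⟩
    ClassX4 W 3 := by
  haveI : Fact (Nat.Prime 3) := ⟨Nat.prime_three⟩
  exact ⟨by norm_num, addv_of_intModel hI 3 (by exact_mod_cast hΔ) (by exact_mod_cast hc₄),
    hasIrreducibleModPGaloisRep_of_hasSurjectiveModNGaloisRep W 3 hsurj⟩

end IntModel

/-! ### §3 The Manin binder from an optimal datum (Agashe–Ribet–Stein 2006 Thm. 2.6) -/

/-- **An OPTIMAL parametrisation datum at a level `N ≤ 130000` has Manin constant prime to `3`**: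
`Λ_E ⊆ c Λ_f` (so `φ_D` is the optimal parametrisation and `c` its Manin constant) and
`N ≤ 130000` give `|c| = 1` by Agashe–Ribet–Stein 2006 Thm. 2.6 (Cremona) — named fact
`cremona_abs_maninConstant_eq_one_of_level_le` (`h26`) — hence the chain's binder
`∃ N D, ¬ 3 ∣ c_D`. [cite: AgasheRibetStein2006, Thm. 2.6 and appendix Thm. 5.2 (first sentence), pp. 619, 633] -/
theorem exists_maninDatum_of_optimal (h26 : cremona_abs_maninConstant_eq_one_of_level_le)
    (W : WeierstrassCurve ℚ) [W.IsElliptic] [W.IsGloballyMinimal] {N : ℕ} [NeZero N]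
    (hN : N ≤ 130000)
    (hopt : ∃ D : ModularParametrizationData W N,
      ∀ z ∈ D.L.lattice, ∃ w ∈ periodLattice D.f, z = D.c * w) :
    ∃ (N' : ℕ) (_ : NeZero N') (D : ModularParametrizationData W N'), ¬ (3 : ℤ) ∣ D.maninConstant := by
  obtain ⟨D, hD⟩ := hopt
  exact ⟨N, inferInstance, D, not_dvd_maninConstant_of_level_le h26 W D hD hN Nat.prime_three⟩

/-! ### §4 The X4-at-`3` chain of record fed by certificates -/

section Chain

variable (W : WeierstrassCurve ℚ) [W.IsElliptic] [W.IsGloballyMinimal]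

/-- **X4 ∧ `r_an = 0` at `p = 3`, certificate form of the chain of record**: ADDITIVE at `3`,
`ρ̄_{E,3}` onto, the `3`-adic tower `ρ̄_{E,3^n}` onto for every `n` (a kernel record, e.g.
`GaloisImage.towerSurj3_v<label>` — Kato's (12.5.2)), `r_an = 0`, `#Ш_an` a `3`-adic unit,
`3 ∤ ∏_ℓ c_ℓ` (so `ord₃ ∏ c_ℓ = ord₃ c₃ = 0`, §1) and an OPTIMAL parametrisation datum at a level
`N ≤ 130000` (so `3 ∤ c_D` by Agashe–Ribet–Stein Thm. 2.6, `h26`, §3) ⟹ `BSD(E,3)`, by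
`X4RankZero.bsdp_of_facts_of_shaAn_unit` (five named facts: sharp Kato A161 `hKatoS`, Delbourgo
1998 Prop. 4 `hDel`, modular parametrisation data `hmodD`, Wuthrich 2014 Lemma 20 `hL20`, Kato's
half-eigen divisibility `hKatoχ`; GZK `hGZK`; modularity `hmod`). On a potentially good row only
`hKatoS` is used; the other four feed the potentially multiplicative branch of the chain.
[cite: Kato2004Asterisque, Thm. 14.5 (3) (p. 236), Prop. 14.16 (2) (p. 244)]
[cite: AgasheRibetStein2006, Thm. 2.6 (p. 619)] [cite: Miller2011LMS, §1 and Def. 1.1] -/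
theorem X4RankZero.bsdp_three_of_towerSurj_of_optimal
    (hKatoS : Kato2004.rankZero_padicValNat_sha_le_sub_localTamagawa_of_additive_potGood_of_imageContainsSL2)
    (hDel : Delbourgo1998.prop4_rankZero_pow_dvd_constantCoeff)
    (hGZK : rank_eq_analyticRank_of_analyticRank_le_one) (hmod : hasEntireLFunction_rat)
    (hmodD : nonempty_modularParametrizationData)
    (hL20 : Wuthrich2014.lemma20_surjective_threeAdic_of_semistable)
    (hKatoχ : Wuthrich2014.kato_halfEigenCharIdeal_dvd_cyclotomicPrime_of_surjective)
    (h26 : cremona_abs_maninConstant_eq_one_of_level_le)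
    (hadd : haveI : Fact (Nat.Prime 3) := ⟨Nat.prime_three⟩; Addv W 3)
    (hsurj : W.HasSurjectiveModNGaloisRep 3)
    (htower : ∀ n : ℕ, W.HasSurjectiveModNGaloisRep (3 ^ n : ℕ))
    (hr : W.analyticRank = 0) {q : ℚ} (hq : shaAn W = (q : ℂ)) (hv : padicValRat 3 q = 0)
    (htam : ¬ 3 ∣ W.tamagawaProduct)
    {N : ℕ} [NeZero N] (hN : N ≤ 130000)
    (hopt : ∃ D : ModularParametrizationData W N,
      ∀ z ∈ D.L.lattice, ∃ w ∈ periodLattice D.f, z = D.c * w) :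
    haveI : Fact (Nat.Prime 3) := ⟨Nat.prime_three⟩
    BSDp W 3 := by
  haveI : Fact (Nat.Prime 3) := ⟨Nat.prime_three⟩
  have hX : ClassX4 W 3 :=
    ⟨by norm_num, hadd, hasIrreducibleModPGaloisRep_of_hasSurjectiveModNGaloisRep W 3 hsurj⟩
  exact X4RankZero.bsdp_of_facts_of_shaAn_unit W 3 hKatoS hDel hGZK hmod hmodD hL20 hKatoχ hr hX
    hsurj (Or.inr ⟨htower, padicValNat_tamagawaProduct_eq_local_of_not_dvd W 3 htam,
      exists_maninDatum_of_optimal h26 W hN hopt⟩) hq hv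

/-- **The same with `Addv` READ OFF THE INTEGER MODEL** (`3 ∣ Δ(E₀)`, `3 ∣ c₄(E₀)`): the shape the
per-pair records `Additive/X4ThreeResCertRecords{1..5}.lean` instantiate, with surj(3) and the
tower supplied by lit-kato's kernel records `GaloisImage.surj3_v<label>` /
`GaloisImage.towerSurj3_v<label>` on the same integral model.
[cite: Kato2004Asterisque, Thm. 14.5 (3) (p. 236)] [cite: SilvermanAEC2009, VII.5 Prop. 5.1 (c)]
[cite: AgasheRibetStein2006, Thm. 2.6 (p. 619)] [cite: Miller2011LMS, §1 and Def. 1.1] -/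
theorem X4RankZero.bsdp_three_of_intModel_of_towerSurj_of_optimal
    (hKatoS : Kato2004.rankZero_padicValNat_sha_le_sub_localTamagawa_of_additive_potGood_of_imageContainsSL2)
    (hDel : Delbourgo1998.prop4_rankZero_pow_dvd_constantCoeff)
    (hGZK : rank_eq_analyticRank_of_analyticRank_le_one) (hmod : hasEntireLFunction_rat)
    (hmodD : nonempty_modularParametrizationData)
    (hL20 : Wuthrich2014.lemma20_surjective_threeAdic_of_semistable)
    (hKatoχ : Wuthrich2014.kato_halfEigenCharIdeal_dvd_cyclotomicPrime_of_surjective)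
    (h26 : cremona_abs_maninConstant_eq_one_of_level_le)
    {E₀ : WeierstrassCurve ℤ} (hI : integralModelInt W = E₀)
    (hΔ : (3 : ℤ) ∣ E₀.Δ) (hc₄ : (3 : ℤ) ∣ E₀.c₄)
    (hsurj : W.HasSurjectiveModNGaloisRep 3)
    (htower : ∀ n : ℕ, W.HasSurjectiveModNGaloisRep (3 ^ n : ℕ))
    (hr : W.analyticRank = 0) {q : ℚ} (hq : shaAn W = (q : ℂ)) (hv : padicValRat 3 q = 0)
    (htam : ¬ 3 ∣ W.tamagawaProduct)
    {N : ℕ} [NeZero N] (hN : N ≤ 130000)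
    (hopt : ∃ D : ModularParametrizationData W N,
      ∀ z ∈ D.L.lattice, ∃ w ∈ periodLattice D.f, z = D.c * w) :
    haveI : Fact (Nat.Prime 3) := ⟨Nat.prime_three⟩
    BSDp W 3 :=
  haveI : Fact (Nat.Prime 3) := ⟨Nat.prime_three⟩
  X4RankZero.bsdp_three_of_towerSurj_of_optimal W hKatoS hDel hGZK hmod hmodD hL20 hKatoχ h26
    (addv_of_intModel hI 3 (by exact_mod_cast hΔ) (by exact_mod_cast hc₄)) hsurj htower hr hq hv
    htam hN hopt

end Chain

end Summit.BirchSwinnertonDyer.Rank1Residual.Additive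

end
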